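import Summits.QuantumFields.YangMills.Theorems.BalabanUVNodesK0RecordFormatNamesLDress
import Literature.MathematicalPhysics.QuantumFieldTheory.Balaban1983to89.B6SectACriticalPointV1

/-!
# K0⁷ — THE RECORD-SIDE FORMAT NAMES, EDITION 16 = RC-3 (H′-lin): THE □₀-LOCALIZED RESPONSE AT LINEAR ORDER OVER THE TREE's [B6] DOMAIN MINIMISER
# `hOp (windowDomains □₀)` — `windowSites ∕ windowDomains ∕ windowSrc ∕ windowResp ∕ recordHrLoc ∕ recordALoc ∕ recordCfgLoc ∕ recordPairLoc ∕ recordJLoc ∕ recordGkLocW ∕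
# recordBox0 ∕ recordGkLoc ∕ recordResponse9DataLoc ∕ recordResponse9DataFromLoc ∕ Response9DAtLoc ∕ recordEmbLoc ∕ IotaRowAtLoc ∕ ResponseRowAtLoc`

Cell `ym-nodeO-ideate` ∕ `ym-balaban-port`, DEFINER seat `ym-nodeO-def-1` (gen 34), on director-ym g20 **№493 RC-3 BUILD DECISION** (nodeO STATUS 2026-08-31T02:08:55Z) = DEF-1's SIZE MEMO
(02:01:57Z) CONFIRMED WITH CRIT-1 g34's J1′ PRE-BUILD SUBSTITUTION (02:03:46Z) and porter PT-B-1 g2's located design catch (02:05:41Z): «OBJECT OF RECORD for the □₀-instance at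
linear order: `recordHrLoc □₀ a l := hOp (windowDomains F Mc k K □₀) (localized source of l)` (+ entrywise complexification as ed.14) from `Literature/…/B6SectACriticalPointV1.lean`
(`existsUnique_isCritical_V1` :208, `isCritical_iff_eq_hOp` :219 = (2.35), `existsUnique_gauge212` :251 = (2.12)_D; unconditional, flat-background V1 = the record's instance K7-c) —
selector-free, Landau on the window, WINDOW-LOCAL BY CONSTRUCTION … REJECTED: the memo's `landauRepCLoc □₀ ∘ recordD` (torus response in a local dressing)».
`--kind definition --supports stmt-QuantumFields-20541 --as helper`; count-neutral.  [I] = [Balaban1987RG1], [15] = [Balaban1985Variational], [B6] = [Balaban1984PropagatorsII].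

PRINT.  [I] p.275 L5–8 «the configuration U_{k+1} is replaced by the configuration U_{k+1}(□₀, M·(U)) extended as equal to U outside □₀»; (3.37) p.277; (4.35) p.290
«E^{(2)}(X) = ½⟨… E″(X, 1), H_j(□₀), H_j(□₀)⟩ … If we replace H_j(□₀) by H_j with free boundary conditions, then the difference H_j(□₀) − H_j restricted to X × supp ζ_□ yields
the factor B₀exp(−δ₀M(L^jη)⁻¹)»; [B6] (2.1)–(2.12) pp.224–225, (2.35) p.228 «A = HB = GQ*(QGQ*)⁻¹B … exactly one critical configuration of (2.5) satisfying (2.6), (2.12)».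

THE OBJECT (linear order, flat background `U₀ = 1` — K7-c).  For a WINDOW `W ⊆ T^{(k+1)}_K` (print's cube □₀ as the set of its big blocks = coarse sites) the [B6] Sect. A
nested family `windowDomains W` is `Ω₀ := T`, `Ω_j^{(j)} :=` the `j`-blocks inside `W` (`1 ≤ j ≤ k+1`), `∅` above: so `Λ₀ = Wᶜ` (fine sites outside the window: «A = B₀ on Λ₀»
with EXTERIOR DATUM `B₀ = 0` — the flat background's zero perturbation, [I] p.275 «extended as equal to U outside □₀»), `Λ_j = ∅` for `1 ≤ j ≤ k`, `Λ_{k+1} = W` («Q_{k+1}A =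
B_{k+1} on W»).  The LOCALIZED SOURCE of the label `l = (μ, y)` is the unit top-level datum at the coarse bond `⟨y, μ⟩` (zero when `y ∉ W`).  The scalar window response
`windowResp W l := H_D e_l = GQ*(QGQ*)⁻¹e_l` ((2.35) at `D = windowDomains W`, unit weights, lattice factor `c = 1`; `∃!`-critical by `existsUnique_isCritical_V1`, Landau
on the window by (2.12)_D — no selector, no choice) is a real fine-bond field supported in the window problem; the 𝔤-valued response in the colour `a` is
`recordHrLoc W a l b := windowResp W l b · ρ₈(bV a)` (at the flat background the linearised problem is the scalar problem in each real coordinate of `ρ₈(bV a)`).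
The 𝐉-block is read, per PT-B-1 (l.4232), from the CURRENT (1.8) OF THE LOCALIZED CONFIGURATION `exp(t·HrLoc)` linearised at `t = 0` (`recordJLoc`) — window-local —
NOT from the rooted global `recordGkJ`.  `recordGkLocW W` = (𝔰𝔩₂-coordinates of `HrLoc`, of `JLoc`); the record's □₀ for the Response9Data slot (which carries no window) is
the cube `recordBox0 R0 l` of radius `R0` (coarse units, displayed parameter) about the source's site; `recordResponse9Data[From]Loc`, receipt `Response9DAtLoc` as ed.14.
JOIN-side (fixed window `W`): the LINEAR localized representation `recordALoc W B := Σ_l windowResp W l · ρ₈(B l)`, the localized configuration `recordCfgLoc W B :=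
exp(recordALoc W B)` read in `SU(2)` (retraction `suOfMat`, as `unitField`), its (1.9) pair `recordPairLoc` and chart `recordEmbLoc W`; receipts (E1′)-Loc `IotaRowAtLoc`,
(E4a)-Loc `ResponseRowAtLoc`.  NOT OFFERED: (E2′)-Loc — the localized and the rooted charts are NOT gauge-related; their link is print's COMPARISON LEMMA (p.290 L17–20,
exponentially small, a porter's theorem later, never a displayed identity); (3.37)'s NONLINEAR localized representative ((H′-full), not commissioned).

HONEST FRAMING.  Definitions only (one proof-bearing def: `windowDomains`' nesting obligations); NOTHING of Bałaban is asserted, ported or discharged; the decay of the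
domain propagator ([I] (4.3) ∕ [15] (190) at the □₀-instance), the comparison lemma and (E4a)-Loc are THEOREMS for porters, not asserted; 27931 OPEN (row 4
MISSTATED-OBJECT, RC-3 in progress: ⁷⁗ «v10-Loc» to be cut over these names by the typer and signed by CRIT-1); 27930⁸∕26648 SIGNED·OPEN; K0⁷∕K-Ax OPEN; NODE O 0∕1;
COUNT 8∕28 · K 1∕4 UNMOVED; finite `𝕋⁴_{L^K}` at fixed ε — NOT continuum ∕ ℝ⁴ ∕ OS; **the Yang–Mills mass gap (Clay) is NOT proved by any of this.**  No `sorry`,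
`instance`, `notation`; standard axioms.
-/

noncomputable section

open scoped BigOperators Matrix.Norms.L2Operator

namespace Summit.QuantumFields.YangMills.Theorems.K0RecordFormatNames

open Literature.MathematicalPhysics.QuantumFieldTheory.Balaban1983to89
open Literature.MathematicalPhysics.QuantumFieldTheory.Balaban1983to89.Node00
open Literature.MathematicalPhysics.QuantumFieldTheory.Balaban1983to89.T4Continuum (T4Family)
open Literature.MathematicalPhysics.QuantumFieldTheory.BalabanImbrieJaffe1984to88.BIJ85AxialPropagator411 (BondSpace)
open Literature.MathematicalPhysics.QuantumFieldTheory.Balaban1983to89.B6SectAOperatorsV1 (BondIdxSpace QsE)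
open Literature.MathematicalPhysics.QuantumFieldTheory.Balaban1983to89.B6SectAVectorModelV1 (GE EE)
open Literature.MathematicalPhysics.QuantumFieldTheory.Balaban1983to89.B5Eq118OneStroke (iterBlockOf)
open NormedSpace (exp)

variable (F : T4Family)

/-! ## §24a  The window □₀, its [B6] Sect. A domain family, the localized source, the scalar window response (2.35)_D -/

/-- **The cube window of radius `R0` about `y₀`** in the `(k+1)`-lattice of `T_K` (print's □₀ as the set of its big blocks = coarse sites): every coordinate within
torus distance `≤ R0`. [cite: Balaban1987RG1, p.274 L8–9, p.275 L5–8] -/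
def windowSites (k K R0 : ℕ) (y₀ : Site (F.P K) (k + 1)) : Finset (Site (F.P K) (k + 1)) :=
  Finset.univ.filter fun y => ∀ μ : Fin (F.P K).d, min (y μ - y₀ μ).val (y₀ μ - y μ).val ≤ R0

open Classical in
/-- **THE [B6] Sect. A DOMAIN FAMILY OF A WINDOW** `W ⊆ T^{(k+1)}`: `Ω₀ := T`, `Ω_j^{(j)} :=` the `j`-blocks all of whose fine sites have their `(k+1)`-block in `W`
(`1 ≤ j ≤ k+1`), `∅` above `k+1`; nested blockwise.  Hence `Λ₀ = Wᶜ` (exterior, datum frozen), `Λ_j = ∅` (`1 ≤ j ≤ k`), `Λ_{k+1} = W`. — the one proof-bearing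
definition of this edition (`Om_zero ∕ Om_eq_empty ∕ nested`). [cite: Balaban1984PropagatorsII, (2.1)–(2.6) p.224; Balaban1987RG1, p.275 L5–8] -/
def windowDomains (k K : ℕ) (hk : k + 1 ≤ (F.P K).m + (F.P K).K) (W : Finset (Site (F.P K) (k + 1))) : B6SectADomainsV1.Domains (F.P K) where
  k := k + 1
  hk := hk
  Om j := if j = 0 then Finset.univ else if j ≤ k + 1 then
      Finset.univ.filter (fun y : Site (F.P K) j => ∀ x : Site (F.P K) 0, iterBlockOf j x = y → iterBlockOf (k + 1) x ∈ W)
    else ∅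
  Om_zero := by simp
  Om_eq_empty j hj := by
    have h1 : j ≠ 0 := by omega
    have h2 : ¬ j ≤ k + 1 := by omega
    simp [h1, h2]
  nested j y hy := by
    by_cases hj0 : j = 0
    · subst hj0; simp
    · have hj1 : j + 1 ≠ 0 := by omega
      by_cases hjk : j + 1 ≤ k + 1
      · simp only [hj1, if_false, hjk, if_true, Finset.mem_filter, Finset.mem_univ, true_and] at hy
        have hjk' : j ≤ k + 1 := by omega
        simp only [hj0, if_false, hjk', if_true, Finset.mem_filter, Finset.mem_univ, true_and]
        intro x hx
        exact hy x (by rw [B5Eq118OneStroke.iterBlockOf_succ, hx])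
      · simp [hjk] at hy

open Classical in
/-- **THE LOCALIZED SOURCE of the label `l = (μ, y)`**: the constraint data `B = (B_j)` of (2.6) with `B_{k+1} =` the indicator of the coarse bond `⟨y, μ⟩` on `Λ_{k+1} = W`
and `B_j = 0` on every other `Λ_j` (exterior datum `B₀ = 0`: the flat background's zero perturbation outside the window). [cite: Balaban1984PropagatorsII, (2.6) p.224; Balaban1987RG1, p.275 L5–8, (3.25) p.275] -/
def windowSrc (k K : ℕ) (hk : k + 1 ≤ (F.P K).m + (F.P K).K) (W : Finset (Site (F.P K) (k + 1))) (l : RespLabel F k K) :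
    BondIdxSpace (windowDomains F k K hk W) :=
  WithLp.toLp 2 fun p => if ((p.1.1 : ℕ) = k + 1 ∧ p.1.2.dir = l.1 ∧
      ∃ x : Site (F.P K) 0, iterBlockOf (p.1.1 : ℕ) x = p.1.2.src ∧ iterBlockOf (k + 1) x = l.2) then 1 else 0

/-- **THE SCALAR WINDOW RESPONSE `windowResp W l := H_D e_l = GQ*(QGQ*)⁻¹e_l`** — [B6] (2.35) on the window domain family `D = windowDomains W`, unit weights, lattice
factor `c = 1`: THE critical configuration of (2.5) under (2.6) with the localized source and (2.12)_D (`existsUnique_isCritical_V1 ∕ isCritical_iff_eq_hOp`, unconditional —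
selector-free), a real fine-bond field; off the standing range `k + 1 ≤ m + K` it is `0`. [cite: Balaban1984PropagatorsII, (2.35) p.228, (2.12) p.225; Balaban1987RG1, (3.37) p.277, (4.35) p.290] -/
def windowResp (k K : ℕ) (W : Finset (Site (F.P K) (k + 1))) (l : RespLabel F k K) : PBond (F.P K) 0 → ℝ := fun b =>
  if hk : k + 1 ≤ (F.P K).m + (F.P K).K then
    WithLp.ofLp (B6SectA.hOp (GE (windowDomains F k K hk W) (one_ne_zero (α := ℝ)) (w := fun _ => (1 : ℝ)) fun _ => one_pos)
      (QsE (windowDomains F k K hk W)) (EE (windowDomains F k K hk W) (one_ne_zero (α := ℝ)) (w := fun _ => (1 : ℝ)) fun _ => one_pos)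
      (windowSrc F k K hk W l)) b
  else 0

/-! ## §24b  The localized response in a colour, the linear localized representation, the localized configuration and its current, the coordinates -/

section Theta

variable (θ : Stage13Params F 2)

/-- ★ **`recordHrLoc F θ k K W a l b i i'`** — THE □₀-LOCALIZED RESPONSE AT LINEAR ORDER in the colour `a`: `windowResp W l b · ρ₈(bV a)_{ii'}` — print's
`(δ∕δB)H_j(□₀, B)` at `B = 0` on the basis field `δ_l ⊗ bV a` ([I] (3.37)∕(4.35)), the flat-background linearised problem being the scalar (2.35)_D problem in each real
coordinate of `ρ₈(bV a)`.  The OBJECT OF RECORD of RC-3 (№493). [cite: Balaban1987RG1, (3.37) p.277, (4.35) p.290, p.275 L5–8; Balaban1984PropagatorsII, (2.35) p.228] -/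
def recordHrLoc (k K : ℕ) (W : Finset (Site (F.P K) (k + 1))) (a : θ.ιβ) (l : RespLabel F k K) : PBond (F.P K) 0 → Fin 2 → Fin 2 → ℂ :=
  letI := θ.instVβ₁; letI := θ.instVβ₂
  fun b i i' => (windowResp F k K W l b : ℂ) * θ.ρ8 (θ.bV a) i i'

/-- **The LINEAR localized representation in the direction `B`**: `A′_B(b) := Σ_l windowResp W l b · ρ₈(B l)` (for `B = δ_l ⊗ bV a` the matrix of `recordHrLoc … a l b`).
[cite: Balaban1987RG1, (4.2) p.281, (3.37) p.277] -/
def recordALoc (k K : ℕ) (W : Finset (Site (F.P K) (k + 1))) (B : Fin (F.P K).d → Site (F.P K) (k + 1) → θ.Vβ) : PBond (F.P K) 0 → MatA 2 :=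
  letI := θ.instVβ₁; letI := θ.instVβ₂
  fun b => ∑ l : RespLabel F k K, (windowResp F k K W l b : ℂ) • θ.ρ8 (B l.1 l.2)

/-- **The LOCALIZED CONFIGURATION `exp(A′_B)`** read in `SU(2)` through the retraction `suOfMat` (the identity on `SU(2)`; same contract as `unitField`) — [I] (3.37)'s
«exp(iξH_j(□₀, …))» at linear order in the exponent. [cite: Balaban1987RG1, (3.37) p.277, (4.2) p.281] -/
def recordCfgLoc (k K : ℕ) (W : Finset (Site (F.P K) (k + 1))) (B : Fin (F.P K).d → Site (F.P K) (k + 1) → θ.Vβ) : GaugeField (F.P K) 0 (SU 2) :=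
  fun b => suOfMat 2 (exp (recordALoc F θ k K W B b))

/-- **The (1.9) PAIR of the localized configuration** `(exp A′_B, J_{k+1}(exp A′_B))` (current (1.8) through `ιSU`, as `recordPairJ`). [cite: Balaban1987RG1, (1.8)–(1.9) p.261, (3.24) p.275] -/
def recordPairLoc (k K : ℕ) (W : Finset (Site (F.P K) (k + 1))) (B : Fin (F.P K).d → Site (F.P K) (k + 1) → θ.Vβ) : Sect2.CPair (F.P K) (MatA 2) :=
  (fun b => ((recordCfgLoc F θ k K W B b : SU 2) : MatA 2),
    B12Eq18Current.current sl2Proj ((F.P K).eta (k + 1)) fun b => ιSU 2 (recordCfgLoc F θ k K W B b))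

/-- **`recordJLoc F θ k K W a l b`** — THE LINEARISED CURRENT OF THE LOCALIZED CONFIGURATION in the direction `δ_l ⊗ bV a`: `d∕dt|₀ J_{k+1}(exp(t·HrLoc))(b)`, entry by
entry (window-local; per PT-B-1 the 𝐉-block of the localized response data — NOT the rooted global `recordGkJ` 𝐉-block; his closed form `−iξ⁻³π d*d HrLoc` is a lemma).
[cite: Balaban1987RG1, (1.8) p.261, (3.24) p.275, (4.35) p.290] -/
def recordJLoc (k K : ℕ) (W : Finset (Site (F.P K) (k + 1))) (a : θ.ιβ) (l : RespLabel F k K) (b : PBond (F.P K) 0) : MatA 2 :=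
  letI := θ.instVβ₁; letI := θ.instVβ₂; letI := θ.instιβ
  Matrix.of fun i i' => deriv (fun t : ℝ => (recordPairLoc F θ k K W (Pi.single l.1 (Pi.single l.2 (t • θ.bV a)))).2 b i i') 0

/-- **`recordGkLocW F θ k K W a l i`** — the two-block LOCALIZED response coordinates at the window `W`: 𝐔-block = 𝔰𝔩₂-coordinates of `recordHrLoc W a l b`, 𝐉-block =
𝔰𝔩₂-coordinates of `recordJLoc W a l b` (`i ↔ (b, colour)` by `chartEquivJ`). [cite: Balaban1987RG1, (4.35) p.290, (1.9) p.261; Balaban1985Variational, Prop. 9 p.309] -/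
def recordGkLocW (k K : ℕ) (W : Finset (Site (F.P K) (k + 1))) (a : θ.ιβ) (l : RespLabel F k K) (i : Fin (recordChartDimJ F K)) : ℂ :=
  Sum.elim
    (fun c => sl2Coord (Matrix.of fun i₁ i₂ => recordHrLoc F θ k K W a l ((chartEquivJ F K).symm i).1 i₁ i₂) c)
    (fun c => sl2Coord (recordJLoc F θ k K W a l ((chartEquivJ F K).symm i).1) c)
    ((chartEquivJ F K).symm i).2

/-! ## §24c  The record's □₀ per source, the response data, the receipt -/

/-- **The record's □₀ for the label `l`**: the cube window of radius `R0` (coarse units; print: a fixed multiple of `M`) about the source's site `l.2`.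
[cite: Balaban1987RG1, p.274 L8–9 (□ ⊂ □̃ ⊂ □₂ ⊂ □₃ ⊂ □₄ ⊂ □₀), (4.35) p.290] -/
def recordBox0 (k K R0 : ℕ) (l : RespLabel F k K) : Finset (Site (F.P K) (k + 1)) :=
  windowSites F k K R0 l.2

/-- **`recordGkLoc F θ k K R0 a l i := recordGkLocW … (recordBox0 R0 l) a l i`** — the localized response coordinates at the record's □₀ (the `Gk`-slot of the response data,
which carries no window). [cite: Balaban1987RG1, (4.35) p.290; Balaban1985Variational, Prop. 9 p.309] -/
def recordGkLoc (k K R0 : ℕ) (a : θ.ιβ) (l : RespLabel F k K) (i : Fin (recordChartDimJ F K)) : ℂ :=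
  recordGkLocW F θ k K (recordBox0 F k K R0 l) a l i

/-- **The localized response data** (unshifted): typer-1's `Response9Data` at the record with `Gk := recordGkLoc … R0`, every other field as in `recordResponse9DataL ∕ J`.
[cite: Balaban1985Variational, Prop. 9 p.309; Balaban1987RG1, (4.35) p.290] -/
def recordResponse9DataLoc (a : θ.ιβ) (Mc k R0 : ℕ) :
    B12FormatPlus.Response9Data (recordDomSys F Mc k) (recordBondCount F) (recordChartDimJ F) 4 where
  Cc := recordCc F Mc k
  Λ := RespLabel F k
  G := recordSiteGeom F Mc k
  ρ := recordRho F k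
  e := recordE F k
  cX := recordCXJ F Mc k
  siteOf := fun K => recordSiteOfJ F k K
  Gk := fun K => recordGkLoc F θ k K R0 a
  wrap := recordWrapCtr F Mc k
  emb := recordDomEmbCtr F Mc k
  jX := fun K _ => recordJXJ F K
  πc := fun K _ => recordCoordProjCtr F K

/-- **The localized response data from the base volume `K₀`** (member `n` = volume `K₀ + n`), `Gk := recordGkLoc … R0`. [cite: Balaban1985Variational, Prop. 9 p.309; Balaban1987RG1, (1.21) p.264, (4.35) p.290] -/
def recordResponse9DataFromLoc (a : θ.ιβ) (Mc k K₀ R0 : ℕ) :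
    B12FormatPlus.Response9Data (fun n => recordDomSys F Mc k (K₀ + n)) (fun n => recordBondCount F (K₀ + n)) (fun n => recordChartDimJ F (K₀ + n)) 4 where
  Cc := fun n => recordCc F Mc k (K₀ + n)
  Λ := fun n => RespLabel F k (K₀ + n)
  G := fun n => recordSiteGeom F Mc k (K₀ + n)
  ρ := fun n => recordRho F k (K₀ + n)
  e := fun n => recordE F k (K₀ + n)
  cX := fun n => recordCXJ F Mc k (K₀ + n)
  siteOf := fun n => recordSiteOfJ F k (K₀ + n)
  Gk := fun n => recordGkLoc F θ k (K₀ + n) R0 a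
  wrap := fun n => recordWrapCtr F Mc k (K₀ + n)
  emb := fun n => recordDomEmbCtr F Mc k (K₀ + n)
  jX := fun n _ => recordJXJ F (K₀ + n)
  πc := fun n _ => recordCoordProjCtr F (K₀ + n)

/-- **RECEIPT (Loc): 27931 ⁷⁗'s response half** — typer-1's `Response9D` in the gauge norm of the two-block (4.4) domain, CENTRED layer, window radius `recordRNat`, from the
base volume `K₀`, with the response THE □₀-LOCALIZED ONE (`recordResponse9DataFromLoc … R0`).  Prop-valued; asserts nothing. [cite: Balaban1985Variational, Prop. 9 p.309; Balaban1987RG1, (4.4) p.281, (4.35) p.290, (1.21) p.264] -/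
def Response9DAtLoc (a : θ.ιβ) (Mc k K₀ R0 : ℕ) (α₂ C₉ δ₀ : ℝ) : Prop :=
  B12FormatPlus.Response9D (recordResponse9DataFromLoc F θ a Mc k K₀ R0) (fun n => recordChartJ F Mc k (K₀ + n)) (fun n => recordRNat F Mc k (K₀ + n))
    (fun n X => recordDom44J F Mc k (K₀ + n) X α₂) C₉ δ₀

/-! ## §24d  JOIN-side: the localized chart at a fixed window and its receipts (E1′)-Loc ∕ (E4a)-Loc -/

/-- **`ι_Loc` — THE LOCALIZED CHART `recordEmbLoc F θ k K W`**: `B ↦ (sl2Coord (log 𝐔_Loc(b)), sl2Coord 𝐉_Loc(b))_b` for the localized pair `recordPairLoc W B` — the two-block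
coordinates `recordEmbJ` takes of the rooted pair, taken of the localized one ([I] (3.24)∕(4.2): «E(X, U_j(□₀, exp iB), J)» in the localized representation).
[cite: Balaban1987RG1, (3.24) p.275, (4.2) p.281, (4.35) p.290, (1.9) p.261] -/
def recordEmbLoc (k K : ℕ) (W : Finset (Site (F.P K) (k + 1))) (B : Fin (F.P K).d → Site (F.P K) (k + 1) → θ.Vβ) : Fin (recordChartDimJ F K) → ℂ :=
  fun i => Sum.elim
    (fun c => sl2Coord (MatrixLog.mlog ((recordPairLoc F θ k K W B).1 ((chartEquivJ F K).symm i).1)) c)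
    (fun c => sl2Coord ((recordPairLoc F θ k K W B).2 ((chartEquivJ F K).symm i).1) c)
    ((chartEquivJ F K).symm i).2

/-- **RECEIPT (E1′)-Loc `IotaRowAtLoc`**: the localized chart is `C²` at `0` and vanishes there. [cite: Balaban1987RG1, (4.35) p.290; Balaban1985Variational, Prop. 9 p.309] -/
def IotaRowAtLoc (k K : ℕ) (W : Finset (Site (F.P K) (k + 1))) : Prop :=
  letI := θ.instVβ₁; letI := θ.instVβ₂
  ContDiffAt ℝ 2 (recordEmbLoc F θ k K W) 0 ∧ recordEmbLoc F θ k K W 0 = 0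

/-- **RECEIPT (E4a)-Loc `ResponseRowAtLoc`**: the FIRST DERIVATIVE of the localized chart at `0` on the basis fields IS `recordGkLocW W` (𝐔-block = `HrLoc`, 𝐉-block = `JLoc`).
To be PROVED (`mlog ∘ suOfMat ∘ exp` at `0`); displayed, not asserted. [cite: Balaban1987RG1, (4.35) p.290; Balaban1985Variational, Prop. 9 p.309] -/
def ResponseRowAtLoc (k K : ℕ) (W : Finset (Site (F.P K) (k + 1))) (a : θ.ιβ) : Prop :=
  letI := θ.instVβ₁; letI := θ.instVβ₂; letI := θ.instιβ
  ∀ (l : RespLabel F k K) (i : Fin (recordChartDimJ F K)),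
    fderiv ℝ (recordEmbLoc F θ k K W) 0 (Pi.single l.1 (Pi.single l.2 (θ.bV a))) i = recordGkLocW F θ k K W a l i

end Theta

end Summit.QuantumFields.YangMills.Theorems.K0RecordFormatNames

end
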